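import Summits.QuantumFields.YangMills.Theorems.BalabanUVNodesN15KingModelBoxEtaRate
import Summits.QuantumFields.YangMills.Theorems.BalabanUVNodesN15KingModelBoxBlockFieldLaw
import Summits.QuantumFields.YangMills.Theorems.BalabanUVNodesN15KingModelBoxReflectionPositivity
import Summits.QuantumFields.YangMills.Theorems.BalabanUVNodesN15KingModelBoxFineLayers
import HarnessLib

/-!
# BalabanUVNodes ∕ N15 — THE KING-MODEL RUNG (PART Ν by name): KING's MULTIPLE REFLECTION REPRESENTATION AT `A = 0` IN ALL `d+1` DIRECTIONS AND ITS
# N15 CONSEQUENCES ON KING's REGION `Ω` — ONE CONJUNCTION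
# (Track A, DAG node N15 = NE2; FAN-OUT v1.1 §N15 s3 «KING-MODEL RUNG» — «torus-vs-box twin»; count-neutral)

HONEST FRAMING.  Count-neutral (cell `pub-ymgap`, seat `pub-ymgap-dag-n15-e` g39; `--supports stmt-QuantumFields-27366 --as helper` = K3⁸).  An INDEX THEOREM over
parts Ν-a…Ν-k (`…KingModelBoxOperator` … `…KingModelBoxFineLayers`), no new mathematics: the nine headline statements BY NAME in one conjunction, so a reader
(and the referee) can check the part's claims against the kernel in one place.  TEMPLATE LITERATURE [King1986] §4 p.670 l.8–13 (the Ω-propagators are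
multiple-reflection sums, after [Ba 4] = [Balaban1983RegularityDecay] (2.42), of the operator with free boundary conditions, «so it is sufficient to prove
Propositions 3.8 and 3.9 for the operator with free boundary conditions»; PART Ν is the periodized, doubled-TORUS form of that representation — a device of
these files, see the erratum paragraph of parts Ν-c∕d∕f v1.1), (2.13)–(2.14) p.653, Lemma 4.3 p.672, (4.39)–(4.41) pp.674–675; [GlimmJaffe1987] §7.10 Thm. 7.10.3; [MontvayMunster1994] §2.2.1.  NOT Bałaban's covariant objects; NOT a node discharge (N15 is
booked through n15-a's knit, untouched); nothing continuum-YM ∕ `ℝ⁴` ∕ OS axioms ∕ Clay.  0 `sorry`, 0 `def`.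

WHAT THIS FILE PROVES (kernel).  ★★★ **`king_box_package`**: for `c > 0`, `m² > 0`, `L ≥ 2`, `a > 0`, every box `Ω = Π_μ{0,…,n_μ−1}` and axis `κ`:
(1) `(c(−Δ_free)+m²)⁻¹(s,t) = Σ_S B⁻¹_{T(2n)}(dblBox s, σ_S dblBox t)` (Ν-a′); (2) `Σ_{s′_κ=a}(c(−Δ_free)+m²)⁻¹(s′,t) = c⁻¹·pathGreen (n κ) (m²∕c) a t_κ` (Ν-b);
(3) `Σ_t G^{Ω}(s,t) = 1∕m²` (Ν-a′); (4) `0 ≤ G^{Ω}(s,t) − B⁻¹_{T(2n)}(dblBox s, dblBox t)` (Ν-a′∕Ν-c); (5) `N(0,(c(−Δ_free)+m²)⁻¹)` is reflection positive about the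
mid-plane of every direction with `n_κ` even (Ν-e); (6) folding is multiplicative on reflection-symmetric operators (Ν-f); (7) `(Δ^{(k)}_Ω)⁻¹ = fold((Δ^{(k)})⁻¹)`
(Ν-g); (8) NE2's unit-layer `η`-rate on `Ω`: `|(Δ^{(K+1)}_Ω)⁻¹ − (Δ^{(K)}_Ω)⁻¹|(b,b′) ≤ 2^{d+1}·C_diff·L^{−K}·e^{−(κ_m∕2)d_Ω(b,b′)}` (Ν-i);
(9) the top piece on the fine box `G^η_{(K)}(Ω_η) = N^d·(G^{Ω_η} − (A₀^Ω)⁻¹)` (Ν-k).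
-/

noncomputable section

open scoped BigOperators symmDiff
open Finset Matrix

namespace Summit.QuantumFields.YangMills.BalabanUVNodes.N15KingModelRung.TorusSpectral

open Literature.MathematicalPhysics.QuantumFieldTheory (gaussianFieldOfKernel)
open Literature.MathematicalPhysics.QuantumFieldTheory.Balaban1983to89.B5Prop11Plancherel (Tor fine unitVec)
open Literature.MathematicalPhysics.QuantumFieldTheory.King1986 (aK)
open Literature.MathematicalPhysics.QuantumFieldTheory.King1986.Torus
open Literature.Probability.LatticeModels (IsReflectionPositive)

variable {d : ℕ} (L : ℕ) [NeZero L] (n : Fin (d + 1) → ℕ) [hn : ∀ μ, NeZero (n μ)] (κ : Fin (d + 1))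

/-- ★★★ **PART Ν BY NAME — KING's MULTIPLE REFLECTION REPRESENTATION AT `A = 0` AND ITS CONSEQUENCES ON `Ω`** (`c > 0`, `m² > 0`, `L ≥ 2`, `a > 0`; every box,
every axis): (1) the box covariance is the `2^{d+1}`-image sum; (2) its zero-momentum timeslices are the 1-d Neumann resolvent with the torus mass;
(3) the sum rule; (4) free boundary conditions only add covariance; (5) reflection positivity of the free-boundary field about every mid-plane (`n_κ` even);
(6) folding is multiplicative; (7) the RG block-field covariance on `Ω` is the fold of the torus one; (8) NE2's unit-layer `η`-rate on `Ω`; (9) NE2's covariance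
piece (King's top piece) on the fine box is the difference of the two folded box kernels.
[cite: King1986, §4 p.670, (2.13)–(2.14) p.653, Lemma 4.3 (4.18) p.672, (4.39)–(4.41) pp.674–675; Balaban1983RegularityDecay, (2.42) p.584;
GlimmJaffe1987, §7.10 Thm. 7.10.3; MontvayMunster1994, §2.2.1 (2.74)–(2.76)] -/
theorem king_box_package (hL : 2 ≤ L) {c m2 a : ℝ} (hc : 0 < c) (hm : 0 < m2) (ha : 0 < a) :
    (∀ s t : KingBox n, (boxOp n c m2)⁻¹ s t
        = ∑ S : Finset (Fin (d + 1)), (lapF (dblPer n) c m2)⁻¹ (dblBox n s) (torReflS (dblPer n) S (dblBox n t)))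
    ∧ (∀ (t : KingBox n) (α : Fin (n κ)),
        ∑ s' : KingBox n, (if s' κ = α then kingBoxGreen n c m2 s' t else 0) = c⁻¹ * pathGreen (n κ) (m2 / c) α (t κ))
    ∧ (∀ s : KingBox n, ∑ t : KingBox n, kingBoxGreen n c m2 s t = m2⁻¹)
    ∧ (∀ s t : KingBox n, 0 ≤ kingBoxGreen n c m2 s t - (lapF (dblPer n) c m2)⁻¹ (dblBox n s) (dblBox n t))
    ∧ (Even (n κ) → IsReflectionPositive (gaussianFieldOfKernel fun s t : KingBox n => (boxOp n c m2)⁻¹ s t) (boxReflPerm n κ)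
        {x : KingBox n | (x κ).val < n κ / 2})
    ∧ (∀ A B : Matrix (Tor (dblPer n)) (Tor (dblPer n)) ℝ, IsReflSymm n B → foldOp n (A * B) = foldOp n A * foldOp n B)
    ∧ (∀ (N : ℕ) [NeZero N], (foldOp n (effLaplacian N (dblPer n) a c m2))⁻¹ = foldOp n (effLaplacian N (dblPer n) a c m2)⁻¹)
    ∧ (∀ (K : ℕ), 1 ≤ K → ∀ b b' : KingBox n,
        |(foldOp n (effLaplacian (L ^ 1 * L ^ K) (dblPer n) (aK a L (K + 1)) (((L ^ 1 * L ^ K : ℕ) : ℝ) ^ 2) m2))⁻¹ b b'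
            - (foldOp n (effLaplacian (L ^ K) (dblPer n) (aK a L K) (((L ^ K : ℕ) : ℝ) ^ 2) m2))⁻¹ b b'|
          ≤ 2 ^ (d + 1) * (CdiffM (d + 1) a m2 L * ((L : ℝ) ^ K)⁻¹
              * Real.exp (-(kapM (d + 1) a m2 L / 2 * tdistT (dblPer n) (dblBox n b) (dblBox n b')))))
    ∧ (∀ (N : ℕ) [NeZero N] (x y : KingBox (fine N n)),
        foldOp (fine N n) (fromKing N n (topPiece N (dblPer n) a c m2)) x y
          = ((N : ℝ) ^ (d + 1)) * (kingBoxGreen (fine N n) c m2 x y - (foldOp (fine N n) (fromKing N n (fineOp N (dblPer n) a c m2)))⁻¹ x y)) :=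
  ⟨fun s t => boxOp_inv_apply n hc.le hm s t,
    fun t α => timeSlice_kingBoxGreen_eq_pathGreen n κ hc hm t α,
    fun s => sum_kingBoxGreen_eq n hc.le hm s,
    fun s t => kingBoxGreen_sub_direct_nonneg n hc.le hm s t,
    fun hn2 => freeField_isReflectionPositive_box n κ hn2 hc.le hm,
    fun A B hB => foldOp_mul n A B hB,
    fun N _ => foldOp_effLaplacian_inv N n ha hc.le hm,
    fun _ hK b b' => abs_fold_blockCov_step_le L n hL ha hm hK b b',
    fun N _ x y => foldOp_topPiece N n ha.le hc.le hm x y⟩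

end Summit.QuantumFields.YangMills.BalabanUVNodes.N15KingModelRung.TorusSpectral
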